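import Summits.Ventures.PercRepro.C041TriDomNormalForm

/-!
# ROW C-041 — THE EXCESS IS NON-NEGATIVE, I: edge statuses, the three-point patterns and THE KEY LEMMA
(p6, gen 41; P6-TWOEXIT-LEAN.md §53)

The framework of the DELETION–CONTRACTION recursion for the excess count `e = N_RRa − N_RB − N_WRj − N_RWj` of
THEOREM (TWO-EXIT NORMAL FORM) (`excess`, `C041TriDomNormalForm`).  Edges of the FIXED host `Z₁` carry a STATUS
(`EStat`: `free` — coloured by `ω`; `absent` — deleted, in neither colour; `double` — contracted, in both colours), so
deletion and contraction never change the vertex or edge types.  `RAdjS` / `BAdjS` are the red / blue adjacencies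
under a status, `RdS` / `MgS` the connectivities (`ZoneData.reach`, as in `ZoneData.Rd` / `ZoneData.Mg`), and the
three-point PATTERNS `rsig` / `bsig` are the Boolean triples `(a₁ ~ u, a₁ ~ u′, u ~ u′)` — always TRANSITIVE
(`Trans3`, i.e. partitions of the three marks: `trans3_rsig`, `trans3_bsig`, by the symmetry and transitivity of
reachability).  `Fanc` is the anchored excess functional on a pair (red pattern, blue pattern) (`+1` on
`RRa = (⊤, ⊥)`, `−1` on `RB`, `WRj`, `RWj`), `Fsym s t = Fanc s t + Fanc t s` its symmetrisation (zero on the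
diagonal, `Fsym_self`).  **THE KEY LEMMA** (`key_lemma`, a `decide` over the transitive Boolean triples): for patterns
`s ≤ s′` and `t ≤ t′` (`Le3` = refinement), `Fsym s t + Fsym s′ t′ ≤ Fsym s′ t + Fsym s t′` — the second mixed
difference of `Fsym` along one coarsening in each colour has the right sign.  (Without transitivity it is FALSE on
102 of the 729 comparable Boolean pairs.)  Continued in `C041TriDomExcessRec` (the recursion) and
`C041TriDomExcessNonneg` (the theorem).
-/

namespace PercRepro

namespace ZoneZ

namespace MultiExit

open ZoneData Finset

variable {V₁ E₁ U₁ U₂ : Type} (Z₁ : ZoneData V₁ E₁ U₁ U₂) (u u' a₁ : V₁)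

/-! ## Edge statuses: deletion and contraction on a fixed host -/

/-- The status of an edge in the deletion–contraction recursion: `free` (coloured by `ω`), `absent` (deleted: in neither
colour), `double` (contracted: in both colours). -/
inductive EStat
  /-- the edge is coloured by `ω` -/
  | free : EStat
  /-- the edge is deleted -/
  | absent : EStat
  /-- the edge is contracted: present in both colours -/
  | double : EStat
  deriving DecidableEq

/-- The edge `e` is red under the status `st` and the colouring `ω`. -/
def redE (st : E₁ → EStat) (ω : E₁ → Bool) (e : E₁) : Prop := st e = .double ∨ (st e = .free ∧ ω e = true)

/-- The edge `e` is blue under the status `st` and the colouring `ω`. -/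
def blueE (st : E₁ → EStat) (ω : E₁ → Bool) (e : E₁) : Prop := st e = .double ∨ (st e = .free ∧ ω e = false)

/-- Red adjacency with statuses. -/
def RAdjS (st : E₁ → EStat) (ω : E₁ → Bool) (x y : V₁) : Prop := ∃ e, Z₁.Joins e x y ∧ redE st ω e

/-- Blue adjacency with statuses. -/
def BAdjS (st : E₁ → EStat) (ω : E₁ → Bool) (x y : V₁) : Prop := ∃ e, Z₁.Joins e x y ∧ blueE st ω e

/-- `v` is red-connected to `k` under the status `st`. -/
def RdS (st : E₁ → EStat) (ω : E₁ → Bool) (k v : V₁) : Prop := v ∈ ZoneData.reach (RAdjS Z₁ st ω) {k}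

/-- `v` is blue-connected to `k` under the status `st`. -/
def MgS (st : E₁ → EStat) (ω : E₁ → Bool) (k v : V₁) : Prop := v ∈ ZoneData.reach (BAdjS Z₁ st ω) {k}

/-- Two status/colouring pairs with the same red edges have the same red adjacency. -/
theorem RAdjS_congr {st st' : E₁ → EStat} {ω ω' : E₁ → Bool} (h : ∀ e, redE st ω e ↔ redE st' ω' e) :
    RAdjS Z₁ st ω = RAdjS Z₁ st' ω' := by
  funext x y
  exact propext (exists_congr fun e => and_congr_right fun _ => h e)

/-- Two status/colouring pairs with the same blue edges have the same blue adjacency. -/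
theorem BAdjS_congr {st st' : E₁ → EStat} {ω ω' : E₁ → Bool} (h : ∀ e, blueE st ω e ↔ blueE st' ω' e) :
    BAdjS Z₁ st ω = BAdjS Z₁ st' ω' := by
  funext x y
  exact propext (exists_congr fun e => and_congr_right fun _ => h e)

/-- `Joins` is symmetric. -/
theorem Joins_symm {e : E₁} {x y : V₁} (h : Z₁.Joins e x y) : Z₁.Joins e y x := by
  unfold ZoneData.Joins at h ⊢
  rcases h with h | h
  · exact Or.inr ⟨h.1, h.2⟩
  · exact Or.inl ⟨h.1, h.2⟩

/-- Red adjacency is symmetric. -/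
theorem RAdjS_symm (st : E₁ → EStat) (ω : E₁ → Bool) (x y : V₁) (h : RAdjS Z₁ st ω x y) : RAdjS Z₁ st ω y x := by
  obtain ⟨e, he, hr⟩ := h
  exact ⟨e, Joins_symm Z₁ he, hr⟩

/-- Blue adjacency is symmetric. -/
theorem BAdjS_symm (st : E₁ → EStat) (ω : E₁ → Bool) (x y : V₁) (h : BAdjS Z₁ st ω x y) : BAdjS Z₁ st ω y x := by
  obtain ⟨e, he, hb⟩ := h
  exact ⟨e, Joins_symm Z₁ he, hb⟩

/-- Membership in the reach of a singleton is the reflexive–transitive closure. -/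
theorem mem_reach_singleton (R : V₁ → V₁ → Prop) (k v : V₁) :
    v ∈ ZoneData.reach R {k} ↔ Relation.ReflTransGen R k v := by
  simp only [ZoneData.reach, Set.mem_setOf_eq, Set.mem_singleton_iff, exists_eq_left]

/-- The reflexive–transitive closure of a symmetric relation is symmetric. -/
theorem rtg_symm {R : V₁ → V₁ → Prop} (hR : ∀ x y, R x y → R y x) {a b : V₁}
    (h : Relation.ReflTransGen R a b) : Relation.ReflTransGen R b a := by
  induction h with
  | refl => exact Relation.ReflTransGen.refl
  | tail _ hbc ih => exact Relation.ReflTransGen.head (hR _ _ hbc) ih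

/-- Transitivity of connectivity through a common vertex, for a symmetric relation. -/
theorem reach_trans_of_symm {R : V₁ → V₁ → Prop} (hR : ∀ x y, R x y → R y x) {k x y : V₁}
    (hx : x ∈ ZoneData.reach R {k}) (hy : y ∈ ZoneData.reach R {k}) : y ∈ ZoneData.reach R {x} := by
  rw [mem_reach_singleton] at hx hy ⊢
  exact (rtg_symm hR hx).trans hy

/-- Connectivity composes. -/
theorem reach_trans' {R : V₁ → V₁ → Prop} {k x y : V₁} (hx : x ∈ ZoneData.reach R {k})
    (hy : y ∈ ZoneData.reach R {x}) : y ∈ ZoneData.reach R {k} := by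
  rw [mem_reach_singleton] at hx hy ⊢
  exact hx.trans hy

/-- Every vertex reaches itself. -/
theorem mem_reach_self (R : V₁ → V₁ → Prop) (k : V₁) : k ∈ ZoneData.reach R {k} :=
  (mem_reach_singleton R k k).mpr Relation.ReflTransGen.refl

/-- Reach is monotone in the relation. -/
theorem reach_mono {R R' : V₁ → V₁ → Prop} (h : ∀ x y, R x y → R' x y) {k v : V₁}
    (hv : v ∈ ZoneData.reach R {k}) : v ∈ ZoneData.reach R' {k} := by
  rw [mem_reach_singleton] at hv ⊢
  induction hv with
  | refl => exact Relation.ReflTransGen.refl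
  | tail _ hbc ih => exact ih.tail (h _ _ hbc)

/-! ## The three-point types -/

/-- A three-point connectivity pattern `(a₁ ~ u, a₁ ~ u′, u ~ u′)`. -/
abbrev P3 := Bool × Bool × Bool

/-- The pattern is transitive (a partition of the three marks). -/
def Trans3 (s : P3) : Prop :=
  (s.1 = true → s.2.1 = true → s.2.2 = true) ∧ (s.1 = true → s.2.2 = true → s.2.1 = true) ∧
    (s.2.1 = true → s.2.2 = true → s.1 = true)

/-- Transitivity is decidable. -/
instance (s : P3) : Decidable (Trans3 s) := by unfold Trans3; infer_instance

/-- `s` refines `t`: every connection of `s` is a connection of `t`. -/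
def Le3 (s t : P3) : Prop := (s.1 = true → t.1 = true) ∧ (s.2.1 = true → t.2.1 = true) ∧ (s.2.2 = true → t.2.2 = true)

/-- Refinement is decidable. -/
instance (s t : P3) : Decidable (Le3 s t) := by unfold Le3; infer_instance

/-- The anchored excess functional on a pair (red pattern, blue pattern): `+1` on `RRa = (⊤, ⊥)`, `−1` on
`RB = (au|u′ ; au′|u)`, `WRj = (au′|u ; uu′|a)`, `RWj = (au|u′ ; uu′|a)`, `0` elsewhere. -/
def Fanc (s t : P3) : ℤ :=
  (if s = (true, true, true) ∧ t = (false, false, false) then 1 else 0)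
    - (if s = (true, false, false) ∧ t = (false, true, false) then 1 else 0)
    - (if s = (false, true, false) ∧ t = (false, false, true) then 1 else 0)
    - (if s = (true, false, false) ∧ t = (false, false, true) then 1 else 0)

/-- The symmetrised excess functional. -/
def Fsym (s t : P3) : ℤ := Fanc s t + Fanc t s

/-- `Fsym` vanishes on the diagonal. -/
theorem Fsym_self (s : P3) : Fsym s s = 0 := by
  revert s; decide

/-- **THE KEY LEMMA**: along one coarsening in each colour the second mixed difference of `Fsym` has the right sign. -/
theorem key_lemma : ∀ s s' t t' : P3, Trans3 s ∧ Trans3 s' ∧ Trans3 t ∧ Trans3 t' ∧ Le3 s s' ∧ Le3 t t' →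
    Fsym s t + Fsym s' t' ≤ Fsym s' t + Fsym s t' := by
  decide

open Classical in
/-- The red pattern of a colouring under a status. -/
noncomputable def rsig (st : E₁ → EStat) (ω : E₁ → Bool) : P3 :=
  (decide (RdS Z₁ st ω a₁ u), decide (RdS Z₁ st ω a₁ u'), decide (RdS Z₁ st ω u u'))

open Classical in
/-- The blue pattern of a colouring under a status. -/
noncomputable def bsig (st : E₁ → EStat) (ω : E₁ → Bool) : P3 :=
  (decide (MgS Z₁ st ω a₁ u), decide (MgS Z₁ st ω a₁ u'), decide (MgS Z₁ st ω u u'))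

/-- The red pattern is a partition. -/
theorem trans3_rsig (st : E₁ → EStat) (ω : E₁ → Bool) : Trans3 (rsig Z₁ u u' a₁ st ω) := by
  simp only [Trans3, rsig, decide_eq_true_eq, RdS]
  refine ⟨fun h1 h2 => ?_, fun h1 h2 => ?_, fun h1 h2 => ?_⟩
  · exact reach_trans_of_symm (RAdjS_symm Z₁ st ω) h1 h2
  · exact reach_trans' h1 h2
  · exact reach_trans' h1 (reach_trans_of_symm (RAdjS_symm Z₁ st ω) h2 (mem_reach_self _ _))

/-- The blue pattern is a partition. -/
theorem trans3_bsig (st : E₁ → EStat) (ω : E₁ → Bool) : Trans3 (bsig Z₁ u u' a₁ st ω) := by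
  simp only [Trans3, bsig, decide_eq_true_eq, MgS]
  refine ⟨fun h1 h2 => ?_, fun h1 h2 => ?_, fun h1 h2 => ?_⟩
  · exact reach_trans_of_symm (BAdjS_symm Z₁ st ω) h1 h2
  · exact reach_trans' h1 h2
  · exact reach_trans' h1 (reach_trans_of_symm (BAdjS_symm Z₁ st ω) h2 (mem_reach_self _ _))

/-- Equal red adjacencies give equal red patterns. -/
theorem rsig_congr {st st' : E₁ → EStat} {ω ω' : E₁ → Bool} (h : RAdjS Z₁ st ω = RAdjS Z₁ st' ω') :
    rsig Z₁ u u' a₁ st ω = rsig Z₁ u u' a₁ st' ω' := by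
  simp only [rsig, RdS, Prod.mk.injEq, decide_eq_decide, h, iff_self, and_self]

/-- Equal blue adjacencies give equal blue patterns. -/
theorem bsig_congr {st st' : E₁ → EStat} {ω ω' : E₁ → Bool} (h : BAdjS Z₁ st ω = BAdjS Z₁ st' ω') :
    bsig Z₁ u u' a₁ st ω = bsig Z₁ u u' a₁ st' ω' := by
  simp only [bsig, MgS, Prod.mk.injEq, decide_eq_decide, h, iff_self, and_self]

end MultiExit

end ZoneZ

end PercRepro
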